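import Summits.QuantumFields.YangMills.Theorems.BalabanUVNodesN19TiltedPriceGauges
import Summits.QuantumFields.YangMills.Theorems.BalabanUVNodesN19LawPrice
import Mathlib.Analysis.SpecialFunctions.Bernstein

/-!
# YM-DAG node N19 (= NE7 proper) — THE LAW-LEVEL PRICE, II: window matching DOES control the law (Bernstein polynomials, every degree)

Cell `pub-ymgap`, HUMAN RULING D-0062 (Track A), R141 (C) wider-strategy seat `pub-ymgap-dag-n19-e` (strategy s3 = ALTERNATIVE CURRENCY), generation
g17, module 4 (siblings: `…N19LawPrice` — the binomial witness, lower half; `…N19LawPriceModulus`, to follow — the explicit modulus `K∕√n + C(n,l₀)√ε` and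
the uniform statement).  Route `Summits/QuantumFields/YangMills/Theses/BalabanUVNodes.lean` rev 25, cluster item K3⁷ «SpineGivenEndpointR13SepCoPH»
(stmt-QuantumFields-20544, dag-lead WORDS-143); filed `--supports` that item `--as helper` (it proves no registered stub).  COUNT-NEUTRAL: elementary
approximation theory ∕ complex analysis ∕ probability over Mathlib (`bernstein`, `bernstein.variance` ∕ `bernstein.probability`, `iteratedDeriv_sub`,
`Integrable.of_bound`) + the tree's `T4GenFunBounds` (`iteratedDeriv_complexMGF_zero_of_abs_le`, `differentiable_complexMGF_of_abs_le`) + the seat's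
p480837 (`norm_complexMGF_sub_complexMGF_le`, `abs_mgf_sub_mgf_le_of_cgf_close`) and p527999 (`norm_iteratedDeriv_le_linlog`) BY NAME; no scheme
object, no Theses import; NOT a discharge claim.

THE RESULT.  The sibling `…N19LawPrice` showed that window matching of cgf's prices the LAW (bounded-Lipschitz test functions) no better than
`log L∕L`, `L = log⁺ε⁻¹`.  Here the positive side, constructive at every degree `n`: ★★ `abs_integral_sub_integral_le_lipschitz_of_cgf_close` — two
probability laws on `[0,1]` with cgf's `ε`-close on `|t| ≤ l₀` and a `K`-Lipschitz `g` with `|g| ≤ G` on `[0,1]` have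
`|∫ g dν − ∫ g dμ| ≤ K∕√n + G·(3A)ⁿ·n!·2εe^{l₀}`, `A = max(1, 2e·max(1,L)∕l₀)`, for EVERY `n ≥ 1`.  Ingredients: §1 QUANTITATIVE BERNSTEIN (Mathlib's
`bernsteinApproximation_uniform` is qualitative): `|∑_k g(k∕n)b_{n,k}(x) − g(x)| ≤ K√(x(1−x)∕n) ≤ K∕(2√n)` by Cauchy–Schwarz against `bernstein.variance`;
§2 THE MOMENT CURRENCY, all orders: `|∫Yⁿdν − ∫Xⁿdμ| ≤ n!·2εe^{l₀B}·(2e·max(1, L∕n)∕l₀)ⁿ` (p527999's all-orders two-constants lemma on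
`f = complexMGF_Y − complexMGF_X`, whose `n`-th derivative at `0` is the moment difference); §3 a Bernstein basis polynomial against `ν − μ` costs
`C(n,k)2^{n−k}` moment differences, and `∑_k C(n,k)2^{n−k} = 3ⁿ`.  The sibling to follow trades `Aⁿ·ε` for `C(n,l₀)√ε` and draws the uniform
statement «∀ η ∃ ε₁»; together with `…N19LawPrice`: the law-level price lies between `c∕… ≍ log L∕L` (no better) and an explicit modulus (this).
NOT CLAIMED: the optimal modulus — Bernstein polynomials converge at rate `n^{−1∕2}` on the Lipschitz class; Jackson's theorem (rate `1∕n`, not in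
Mathlib) would give `C(l₀)(K+G)·log(e+L)∕(1+L)`, matching the sibling's lower bound; the optimisation in `n` is not typed either.

HONEST FRAMING (binding).  Elementary and [folklore]; NO consumer in the DAG today (value: what g9's continuum law p504707 ∕ p505344 can carry — a
genuine modulus in the window data); nothing of Bałaban's is instantiated; NE7 ∕ NE7b ∕ NE7c NOT PRINTED, NOT proved; N19 NOT discharged; count-neutral.
One finite `T⁴` programme at fixed `ε`; nothing continuum ∕ `ℝ⁴` ∕ OS ∕ mass-gap ∕ Clay.  0 `def` ∕ 0 `sorry`.
-/

noncomputable section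

open Real Finset MeasureTheory ProbabilityTheory
open scoped unitInterval

namespace Summit.QuantumFields.YangMills.Theorems.BalabanUVNodesN19LawPriceUpper

open Literature.MathematicalPhysics.QuantumFieldTheory.Balaban1983to89
open Summit.QuantumFields.YangMills.BalabanUVNodes.N19ExpectationCurrencyTwoConstants
  (norm_complexMGF_sub_complexMGF_le abs_mgf_sub_mgf_le_of_cgf_close)
open Summit.QuantumFields.YangMills.Theorems.BalabanUVNodesN19TiltedPriceGauges (norm_iteratedDeriv_le_linlog)
open Summit.QuantumFields.YangMills.Theorems.BalabanUVNodesN19NoLinearPrice (ae_abs_le_one_of_Icc)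

/-! ## §1 Quantitative Bernstein: a `K`-Lipschitz function is `K√(x(1−x)∕n)`-close to its `n`-th Bernstein polynomial [folklore] -/

/-- Cauchy–Schwarz against the Bernstein weights: `∑_k |k∕n − x|·b_{n,k}(x) ≤ √(x(1−x)∕n)` (Mathlib `bernstein.variance` ∕ `bernstein.probability`).
[folklore] -/
theorem sum_abs_sub_mul_bernstein_le {n : ℕ} (hn : n ≠ 0) (x : I) :
    ∑ k : Fin (n + 1), |(k : ℝ) / n - x| * bernstein n k x ≤ Real.sqrt ((x : ℝ) * (1 - x) / n) := by
  have hb0 : ∀ k : Fin (n + 1), 0 ≤ bernstein n k x := fun k => bernstein_nonneg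
  have hvar : ∑ k : Fin (n + 1), ((x : ℝ) - (k : ℝ) / n) ^ 2 * bernstein n k x = (x : ℝ) * (1 - x) / n := by
    have h := bernstein.variance hn x
    simpa [bernstein.z] using h
  have hprob : ∑ k : Fin (n + 1), bernstein n k x = 1 := bernstein.probability n x
  have hcs := sum_mul_sq_le_sq_mul_sq Finset.univ
    (fun k : Fin (n + 1) => |(k : ℝ) / n - x| * Real.sqrt (bernstein n k x)) (fun k => Real.sqrt (bernstein n k x))
  have h1 : ∀ k : Fin (n + 1), |(k : ℝ) / n - x| * Real.sqrt (bernstein n k x) * Real.sqrt (bernstein n k x) =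
      |(k : ℝ) / n - x| * bernstein n k x := fun k => by
    rw [mul_assoc, Real.mul_self_sqrt (hb0 k)]
  have h2 : ∀ k : Fin (n + 1), (|(k : ℝ) / n - x| * Real.sqrt (bernstein n k x)) ^ 2 =
      ((x : ℝ) - (k : ℝ) / n) ^ 2 * bernstein n k x := fun k => by
    rw [mul_pow, sq_abs, Real.sq_sqrt (hb0 k), ← neg_sub, neg_sq]
  have h3 : ∀ k : Fin (n + 1), Real.sqrt (bernstein n k x) ^ 2 = bernstein n k x := fun k => Real.sq_sqrt (hb0 k)
  simp only [h1, h2, h3, hvar, hprob, mul_one] at hcs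
  refine Real.le_sqrt_of_sq_le hcs

/-- **QUANTITATIVE BERNSTEIN.**  If `|g(u) − g(v)| ≤ K|u − v|` for `u, v ∈ [0,1]`, then for every `n ≥ 1` and `x ∈ [0,1]`
`|∑_k g(k∕n)·b_{n,k}(x) − g(x)| ≤ K·√(x(1−x)∕n) ≤ K∕(2√n)` — Bernstein's proof of Weierstrass made quantitative on the Lipschitz class (Mathlib's
`bernsteinApproximation_uniform` is the qualitative statement). [folklore] -/
theorem abs_bernstein_sum_sub_le {g : ℝ → ℝ} {K : ℝ}
    (hK : ∀ u v : ℝ, u ∈ Set.Icc (0 : ℝ) 1 → v ∈ Set.Icc (0 : ℝ) 1 → |g u - g v| ≤ K * |u - v|)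
    {n : ℕ} (hn : n ≠ 0) (x : I) :
    |∑ k : Fin (n + 1), g ((k : ℝ) / n) * bernstein n k x - g x| ≤ K * Real.sqrt ((x : ℝ) * (1 - x) / n) := by
  have hb0 : ∀ k : Fin (n + 1), 0 ≤ bernstein n k x := fun k => bernstein_nonneg
  have hprob : ∑ k : Fin (n + 1), bernstein n k x = 1 := bernstein.probability n x
  have hK0 : 0 ≤ K := by
    have h := hK 0 1 (by simp) (by simp)
    have : (0 : ℝ) ≤ |g 0 - g 1| := abs_nonneg _
    rw [zero_sub, abs_neg, abs_one, mul_one] at h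
    linarith
  have hgrid : ∀ k : Fin (n + 1), ((k : ℝ) / n) ∈ Set.Icc (0 : ℝ) 1 := fun k => by
    have hnr : (0 : ℝ) < n := by exact_mod_cast Nat.pos_of_ne_zero hn
    refine ⟨by positivity, ?_⟩
    rw [div_le_one hnr]
    exact_mod_cast Nat.lt_succ_iff.mp k.is_lt
  calc |∑ k : Fin (n + 1), g ((k : ℝ) / n) * bernstein n k x - g x|
      = |∑ k : Fin (n + 1), (g ((k : ℝ) / n) - g x) * bernstein n k x| := by
        congr 1
        have e : ∑ k : Fin (n + 1), (g ((k : ℝ) / n) - g x) * bernstein n k x =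
            ∑ k : Fin (n + 1), g ((k : ℝ) / n) * bernstein n k x - g x * ∑ k : Fin (n + 1), bernstein n k x := by
          rw [Finset.mul_sum, ← Finset.sum_sub_distrib]
          exact Finset.sum_congr rfl fun k _ => by ring
        rw [e, hprob, mul_one]
    _ ≤ ∑ k : Fin (n + 1), |(g ((k : ℝ) / n) - g x) * bernstein n k x| := abs_sum_le_sum_abs _ _
    _ ≤ ∑ k : Fin (n + 1), K * (|(k : ℝ) / n - x| * bernstein n k x) := by
        refine sum_le_sum fun k _ => ?_
        rw [abs_mul, abs_of_nonneg (hb0 k), ← mul_assoc]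
        exact mul_le_mul_of_nonneg_right (hK _ _ (hgrid k) x.2) (hb0 k)
    _ = K * ∑ k : Fin (n + 1), |(k : ℝ) / n - x| * bernstein n k x := (Finset.mul_sum _ _ _).symm
    _ ≤ K * Real.sqrt ((x : ℝ) * (1 - x) / n) := mul_le_mul_of_nonneg_left (sum_abs_sub_mul_bernstein_le hn x) hK0

/-- … and `√(x(1−x)∕n) ≤ 1∕(2√n)`. [folklore] -/
theorem sqrt_mul_one_sub_div_le {n : ℕ} (hn : n ≠ 0) (x : I) :
    Real.sqrt ((x : ℝ) * (1 - x) / n) ≤ 1 / (2 * Real.sqrt n) := by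
  have hnr : (0 : ℝ) < n := by exact_mod_cast Nat.pos_of_ne_zero hn
  have h4 : (x : ℝ) * (1 - x) ≤ 1 / 4 := by nlinarith [sq_nonneg ((x : ℝ) - 1 / 2)]
  calc Real.sqrt ((x : ℝ) * (1 - x) / n) ≤ Real.sqrt (1 / 4 / n) := Real.sqrt_le_sqrt (by gcongr)
    _ = 1 / (2 * Real.sqrt n) := by
        rw [Real.sqrt_div (by norm_num), show (1 / 4 : ℝ) = (1 / 2) ^ 2 by norm_num, Real.sqrt_sq (by norm_num)]
        field_simp

/-! ## §2 MOMENTS from window matching: `|∫Yⁿdν − ∫Xⁿdμ| ≤ n!·2εe^{l₀B}·(2e·max(1, L∕n)∕l₀)ⁿ` [folklore] -/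

section Moments

variable {Ω Ω' : Type*} [MeasurableSpace Ω] [MeasurableSpace Ω'] {μ : Measure Ω} {ν : Measure Ω'}
  [IsProbabilityMeasure μ] [IsProbabilityMeasure ν] {X : Ω → ℝ} {Y : Ω' → ℝ} {B : ℝ}

/-- **MOMENTS FROM WINDOW MATCHING (all orders, lin-polylog).**  Two probability spaces, `|X|, |Y| ≤ B` a.e.; if the cgf's are `ε`-close on
`|t| ≤ l₀` (`0 < l₀`, `0 ≤ ε`) then for every `n ≥ 1`
`|∫ Yⁿ dν − ∫ Xⁿ dμ| ≤ n!·(2εe^{l₀B})·(2e·max(1, log⁺ε⁻¹∕n)∕l₀)ⁿ` — p527999's all-orders two-constants lemma `norm_iteratedDeriv_le_linlog` for the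
entire function `f = complexMGF_Y − complexMGF_X` (`‖f‖ ≤ 2e^{l₀B}` on the disc `‖z‖ ≤ l₀`, `≤ 2εe^{l₀B}` on its real diameter by p480837's
`abs_mgf_sub_mgf_le_of_cgf_close`), whose `n`-th derivative at `0` IS the moment difference (`T4GenFunBounds.iteratedDeriv_complexMGF_zero_of_abs_le`).
The seat's expectation price at `n = 1` without the `log log` (that needs the sine gauge of p516009); here all `n` at once. [folklore] -/
theorem abs_moment_sub_le_of_cgf_close (hX : AEMeasurable X μ) (hY : AEMeasurable Y ν) (hXB : ∀ᵐ ω ∂μ, |X ω| ≤ B)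
    (hYB : ∀ᵐ ω ∂ν, |Y ω| ≤ B) {ε l₀ : ℝ} (hl₀ : 0 < l₀) (hε0 : 0 ≤ ε)
    (hε : ∀ t : ℝ, |t| ≤ l₀ → |cgf Y ν t - cgf X μ t| ≤ ε) {n : ℕ} (hn : 1 ≤ n) :
    |∫ ω, Y ω ^ n ∂ν - ∫ ω, X ω ^ n ∂μ| ≤
      n.factorial * (2 * ε * Real.exp (l₀ * B)) * (2 * Real.exp 1 * max 1 (Real.posLog ε⁻¹ / n) / l₀) ^ n := by
  have hB0 : 0 ≤ B := T4GenFunBounds.nonneg_of_ae_abs_le (IsProbabilityMeasure.ne_zero μ) hXB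
  have hdY := T4GenFunBounds.differentiable_complexMGF_of_abs_le hY hYB
  have hdX := T4GenFunBounds.differentiable_complexMGF_of_abs_le hX hXB
  have hfd : Differentiable ℂ (complexMGF Y ν - complexMGF X μ) := hdY.sub hdX
  have hM : ∀ z : ℂ, ‖z‖ ≤ l₀ → ‖(complexMGF Y ν - complexMGF X μ) z‖ ≤ 2 * Real.exp (l₀ * B) := fun z hz => by
    rw [Pi.sub_apply]
    refine (norm_complexMGF_sub_complexMGF_le hXB hYB z).trans ?_
    gcongr
  have hm : ∀ x : ℝ, |x| < l₀ → ‖(complexMGF Y ν - complexMGF X μ) x‖ ≤ 2 * ε * Real.exp (l₀ * B) := fun x hx => by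
    rw [Pi.sub_apply, complexMGF_ofReal, complexMGF_ofReal, ← Complex.ofReal_sub, Complex.norm_real, Real.norm_eq_abs]
    refine (abs_mgf_sub_mgf_le_of_cgf_close hX hY hXB hYB (hε x hx.le)).trans ?_
    gcongr
  have key := norm_iteratedDeriv_le_linlog (E := ℂ) hn hl₀ hfd hM hm (by positivity)
  have hid : iteratedDeriv n (complexMGF Y ν - complexMGF X μ) 0 = ((∫ ω, Y ω ^ n ∂ν - ∫ ω, X ω ^ n ∂μ : ℝ) : ℂ) := by
    rw [iteratedDeriv_sub hdY.contDiff.contDiffAt hdX.contDiff.contDiffAt,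
      T4GenFunBounds.iteratedDeriv_complexMGF_zero_of_abs_le hY hYB,
      T4GenFunBounds.iteratedDeriv_complexMGF_zero_of_abs_le hX hXB, Complex.ofReal_sub]
    rfl
  have hratio : 2 * Real.exp (l₀ * B) / (2 * ε * Real.exp (l₀ * B)) = ε⁻¹ := by
    rcases eq_or_lt_of_le hε0 with h | h
    · rw [← h]; simp
    · field_simp
  rw [hid, Complex.norm_real, Real.norm_eq_abs, hratio] at key
  exact key

end Moments

/-! ## §3 Laws on `[0, 1]`: integrating polynomials in Bernstein form against the difference of two laws -/

section Laws

variable {μ ν : Measure ℝ} [IsProbabilityMeasure μ] [IsProbabilityMeasure ν]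

/-- A law on `[0,1]` lives on `[0,1]` almost everywhere. [folklore] -/
theorem ae_mem_Icc_of_Icc {κ : Measure ℝ} (hκ : κ (Set.Icc 0 1)ᶜ = 0) : ∀ᵐ x ∂κ, x ∈ Set.Icc (0 : ℝ) 1 := by
  rw [ae_iff]
  simpa only [Set.mem_Icc, Set.compl_def] using hκ

/-- Under a law on `[0,1]` every continuous function is integrable (it is a.e. bounded by its sup on `[0,1]`). [folklore] -/
theorem integrable_of_continuous_Icc {κ : Measure ℝ} [IsProbabilityMeasure κ] (hκ : κ (Set.Icc 0 1)ᶜ = 0) {φ : ℝ → ℝ}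
    (hφ : Continuous φ) : Integrable φ κ := by
  obtain ⟨C, hC⟩ := isCompact_Icc.exists_bound_of_continuousOn (hφ.continuousOn (s := Set.Icc (0 : ℝ) 1))
  exact Integrable.of_bound hφ.aestronglyMeasurable C ((ae_mem_Icc_of_Icc hκ).mono fun x hx => hC x hx)

/-- **A BERNSTEIN BASIS POLYNOMIAL AGAINST `ν − μ`.**  For laws `μ, ν` on `[0,1]` whose moment differences of orders `≤ n` are `≤ D`:
`|∫ C(n,k)x^k(1−x)^{n−k} dν − ∫ C(n,k)x^k(1−x)^{n−k} dμ| ≤ C(n,k)·2^{n−k}·D` (expand `(1−x)^{n−k}`; `∑_i C(n−k,i) = 2^{n−k}`). [folklore] -/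
theorem abs_integral_bernstein_sub_le (hμ : μ (Set.Icc 0 1)ᶜ = 0) (hν : ν (Set.Icc 0 1)ᶜ = 0) {n : ℕ} {D : ℝ}
    (hD : ∀ j : ℕ, j ≤ n → |∫ x, x ^ j ∂ν - ∫ x, x ^ j ∂μ| ≤ D) {k : ℕ} (hk : k ≤ n) :
    |∫ x, (n.choose k : ℝ) * x ^ k * (1 - x) ^ (n - k) ∂ν - ∫ x, (n.choose k : ℝ) * x ^ k * (1 - x) ^ (n - k) ∂μ| ≤
      (n.choose k : ℝ) * 2 ^ (n - k) * D := by
  have hD0 : 0 ≤ D := le_trans (abs_nonneg _) (hD 0 (Nat.zero_le n))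
  -- monomial expansion
  have hexp : ∀ x : ℝ, (n.choose k : ℝ) * x ^ k * (1 - x) ^ (n - k) =
      ∑ i ∈ range (n - k + 1), ((n.choose k : ℝ) * ((-1) ^ i * ((n - k).choose i : ℝ))) * x ^ (k + i) := by
    intro x
    rw [sub_eq_add_neg, add_comm, add_pow, mul_sum]
    refine sum_congr rfl fun i _ => ?_
    rw [one_pow, mul_one, neg_pow, pow_add]
    ring
  have hint : ∀ (κ : Measure ℝ) [IsProbabilityMeasure κ], κ (Set.Icc 0 1)ᶜ = 0 →
      ∫ x, (n.choose k : ℝ) * x ^ k * (1 - x) ^ (n - k) ∂κ =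
        ∑ i ∈ range (n - k + 1), ((n.choose k : ℝ) * ((-1) ^ i * ((n - k).choose i : ℝ))) * ∫ x, x ^ (k + i) ∂κ := by
    intro κ _ hκ
    simp_rw [hexp]
    rw [integral_finsetSum _ fun i _ => (integrable_of_continuous_Icc hκ (by fun_prop)).const_mul _]
    exact sum_congr rfl fun i _ => integral_const_mul _ _
  rw [hint ν hν, hint μ hμ, ← sum_sub_distrib]
  calc |∑ i ∈ range (n - k + 1), ((n.choose k : ℝ) * ((-1) ^ i * ((n - k).choose i : ℝ)) * ∫ x, x ^ (k + i) ∂ν -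
          (n.choose k : ℝ) * ((-1) ^ i * ((n - k).choose i : ℝ)) * ∫ x, x ^ (k + i) ∂μ)|
      ≤ ∑ i ∈ range (n - k + 1), |(n.choose k : ℝ) * ((-1) ^ i * ((n - k).choose i : ℝ)) * ∫ x, x ^ (k + i) ∂ν -
          (n.choose k : ℝ) * ((-1) ^ i * ((n - k).choose i : ℝ)) * ∫ x, x ^ (k + i) ∂μ| := abs_sum_le_sum_abs _ _
    _ ≤ ∑ i ∈ range (n - k + 1), (n.choose k : ℝ) * ((n - k).choose i : ℝ) * D := by
        refine sum_le_sum fun i hi => ?_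
        have hi' : k + i ≤ n := by have := mem_range.1 hi; omega
        rw [← mul_sub, abs_mul, abs_mul, abs_mul, abs_pow, abs_neg, abs_one, one_pow, one_mul, Nat.abs_cast, Nat.abs_cast]
        exact mul_le_mul_of_nonneg_left (hD _ hi') (by positivity)
    _ = (n.choose k : ℝ) * 2 ^ (n - k) * D := by
        rw [← sum_mul, ← mul_sum]
        congr 2
        exact_mod_cast Nat.sum_range_choose (n - k)

end Laws

/-! ## §4 THE LAW-LEVEL PRICE FROM ABOVE: Lipschitz test functions against laws whose cgf's match on a window -/

section Price

variable {μ ν : Measure ℝ} [IsProbabilityMeasure μ] [IsProbabilityMeasure ν]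

/-- §2 for laws on `[0,1]`, uniformly over the orders `j ≤ n`: `|∫x^j dν − ∫x^j dμ| ≤ n!·2εe^{l₀}·Aⁿ`, `A = max(1, 2e·max(1,L)∕l₀)` (`j = 0`: both sides
have mass `1`). [folklore] -/
theorem abs_moment_sub_le_uniform (hμ : μ (Set.Icc 0 1)ᶜ = 0) (hν : ν (Set.Icc 0 1)ᶜ = 0) {ε l₀ : ℝ} (hl₀ : 0 < l₀) (hε0 : 0 ≤ ε)
    (hε : ∀ t : ℝ, |t| ≤ l₀ → |cgf id ν t - cgf id μ t| ≤ ε) {n j : ℕ} (hj : j ≤ n) :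
    |∫ x, x ^ j ∂ν - ∫ x, x ^ j ∂μ| ≤
      n.factorial * (2 * ε * Real.exp l₀) * (max 1 (2 * Real.exp 1 * max 1 (Real.posLog ε⁻¹) / l₀)) ^ n := by
  rcases Nat.eq_zero_or_pos j with rfl | hj1
  · simp only [pow_zero, integral_const, smul_eq_mul, mul_one, probReal_univ, sub_self, abs_zero]
    positivity
  · have h := abs_moment_sub_le_of_cgf_close (μ := μ) (ν := ν) (X := id) (Y := id) (B := 1) aemeasurable_id aemeasurable_id
      (ae_abs_le_one_of_Icc hμ) (ae_abs_le_one_of_Icc hν) hl₀ hε0 hε hj1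
    simp only [id, mul_one] at h
    refine h.trans ?_
    have hA1 : 1 ≤ max 1 (2 * Real.exp 1 * max 1 (Real.posLog ε⁻¹) / l₀) := le_max_left _ _
    have hbase : 2 * Real.exp 1 * max 1 (Real.posLog ε⁻¹ / j) / l₀ ≤ max 1 (2 * Real.exp 1 * max 1 (Real.posLog ε⁻¹) / l₀) := by
      refine le_trans ?_ (le_max_right _ _)
      gcongr
      have hj1r : (1 : ℝ) ≤ j := by exact_mod_cast Nat.succ_le_of_lt hj1
      exact div_le_self Real.posLog_nonneg hj1r
    calc (j.factorial : ℝ) * (2 * ε * Real.exp l₀) * (2 * Real.exp 1 * max 1 (Real.posLog ε⁻¹ / j) / l₀) ^ j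
        ≤ n.factorial * (2 * ε * Real.exp l₀) * (max 1 (2 * Real.exp 1 * max 1 (Real.posLog ε⁻¹) / l₀)) ^ j := by
          gcongr
      _ ≤ n.factorial * (2 * ε * Real.exp l₀) * (max 1 (2 * Real.exp 1 * max 1 (Real.posLog ε⁻¹) / l₀)) ^ n := by
          gcongr

/-- **★★ THE LAW-LEVEL PRICE FROM ABOVE (explicit, every degree `n`).**  Two probability laws `μ, ν` on `[0,1]` with cgf's `ε`-close on `|t| ≤ l₀`
(`0 < l₀`, `0 ≤ ε`), a test function `g`, `K`-Lipschitz with `|g| ≤ G` on `[0,1]`.  Then for every `n ≥ 1`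
`|∫ g dν − ∫ g dμ| ≤ K∕√n + G·(3A)ⁿ·n!·2εe^{l₀}`, `A = max(1, 2e·max(1, log⁺ε⁻¹)∕l₀)`
— replace `g` by its `n`-th Bernstein polynomial (§1: uniform error `K∕(2√n)` on `[0,1]`, where both laws live) and integrate the polynomial against
`ν − μ` in the Bernstein basis (§3 with the moment currency of §2 ∕ §4: `∑_k C(n,k)2^{n−k} = 3ⁿ`).  So window matching DOES control the law in the
bounded-Lipschitz metric, with an explicit modulus (§5: `≤ K∕√n + G·C(n,l₀)·√ε`); the sibling `…N19LawPrice` shows no modulus better than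
`log L∕L` exists.  NOT CLAIMED: the optimal modulus — Jackson's theorem (rate `1∕n` on the Lipschitz class, not Bernstein's `1∕√n`) would give
`C(l₀)(K+G)·log(e+L)∕(1+L)`, matching the sibling; neither Jackson nor the optimisation in `n` is typed here. [folklore] -/
theorem abs_integral_sub_integral_le_lipschitz_of_cgf_close (hμ : μ (Set.Icc 0 1)ᶜ = 0) (hν : ν (Set.Icc 0 1)ᶜ = 0)
    {ε l₀ : ℝ} (hl₀ : 0 < l₀) (hε0 : 0 ≤ ε) (hε : ∀ t : ℝ, |t| ≤ l₀ → |cgf id ν t - cgf id μ t| ≤ ε)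
    {g : ℝ → ℝ} {K : NNReal} (hg : LipschitzWith K g) {G : ℝ} (hG : ∀ x ∈ Set.Icc (0 : ℝ) 1, |g x| ≤ G) {n : ℕ} (hn : 1 ≤ n) :
    |∫ x, g x ∂ν - ∫ x, g x ∂μ| ≤
      K / Real.sqrt n + G * (3 * max 1 (2 * Real.exp 1 * max 1 (Real.posLog ε⁻¹) / l₀)) ^ n *
        (n.factorial * (2 * ε * Real.exp l₀)) := by
  have hn0 : n ≠ 0 := by omega
  have hnr : (0 : ℝ) < n := by exact_mod_cast hn
  have hG0 : 0 ≤ G := (abs_nonneg _).trans (hG 0 (by simp))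
  have hgrid : ∀ k ∈ range (n + 1), ((k : ℝ) / n) ∈ Set.Icc (0 : ℝ) 1 := fun k hk => by
    refine ⟨by positivity, ?_⟩
    rw [div_le_one hnr]
    exact_mod_cast Nat.lt_succ_iff.mp (mem_range.mp hk)
  -- the `n`-th Bernstein polynomial of `g`, as a function on `ℝ`
  set p : ℝ → ℝ := fun x => ∑ k ∈ range (n + 1), g ((k : ℝ) / n) * ((n.choose k : ℝ) * x ^ k * (1 - x) ^ (n - k)) with hp
  have hpc : Continuous p := by simp only [hp]; fun_prop
  have hgc : Continuous g := hg.continuous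
  have hK : ∀ u v : ℝ, u ∈ Set.Icc (0 : ℝ) 1 → v ∈ Set.Icc (0 : ℝ) 1 → |g u - g v| ≤ K * |u - v| := fun u v _ _ => by
    have h := hg.dist_le_mul u v
    simpa only [Real.dist_eq] using h
  -- on `[0,1]`, `p` is `K∕(2√n)`-close to `g`
  have hclose : ∀ x ∈ Set.Icc (0 : ℝ) 1, |p x - g x| ≤ K / (2 * Real.sqrt n) := by
    intro x hx
    have e : p x = ∑ k : Fin (n + 1), g ((k : ℝ) / n) * bernstein n k ⟨x, hx⟩ := by
      simp only [hp, bernstein_apply]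
      rw [Finset.sum_range (fun k => g ((k : ℝ) / n) * ((n.choose k : ℝ) * x ^ k * (1 - x) ^ (n - k)))]
    rw [e]
    refine (abs_bernstein_sum_sub_le hK hn0 ⟨x, hx⟩).trans ?_
    calc (K : ℝ) * Real.sqrt (x * (1 - x) / n) ≤ K * (1 / (2 * Real.sqrt n)) :=
          mul_le_mul_of_nonneg_left (sqrt_mul_one_sub_div_le hn0 ⟨x, hx⟩) K.2
      _ = K / (2 * Real.sqrt n) := by ring
  -- `g − p` integrates to at most `K∕(2√n)` under each law
  have hgp : ∀ (κ : Measure ℝ) [IsProbabilityMeasure κ], κ (Set.Icc 0 1)ᶜ = 0 →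
      |∫ x, g x ∂κ - ∫ x, p x ∂κ| ≤ K / (2 * Real.sqrt n) := by
    intro κ _ hκ
    rw [← integral_sub (integrable_of_continuous_Icc hκ hgc) (integrable_of_continuous_Icc hκ hpc)]
    have h := norm_integral_le_of_norm_le_const (μ := κ) (f := fun x => g x - p x) (C := K / (2 * Real.sqrt n))
      ((ae_mem_Icc_of_Icc hκ).mono fun x hx => by rw [Real.norm_eq_abs, abs_sub_comm]; exact hclose x hx)
    rwa [probReal_univ, mul_one, Real.norm_eq_abs] at h
  -- `p` against `ν − μ`: the Bernstein basis against the moment currency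
  set A := max 1 (2 * Real.exp 1 * max 1 (Real.posLog ε⁻¹) / l₀) with hA
  set D := (n.factorial : ℝ) * (2 * ε * Real.exp l₀) * A ^ n with hD
  have hDj : ∀ j : ℕ, j ≤ n → |∫ x, x ^ j ∂ν - ∫ x, x ^ j ∂μ| ≤ D := fun j hj =>
    abs_moment_sub_le_uniform hμ hν hl₀ hε0 hε hj
  have hlin : ∀ (κ : Measure ℝ) [IsProbabilityMeasure κ], κ (Set.Icc 0 1)ᶜ = 0 →
      ∫ x, p x ∂κ = ∑ k ∈ range (n + 1), g ((k : ℝ) / n) * ∫ x, (n.choose k : ℝ) * x ^ k * (1 - x) ^ (n - k) ∂κ := by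
    intro κ _ hκ
    simp only [hp]
    rw [integral_finsetSum _ fun k _ => (integrable_of_continuous_Icc hκ (by fun_prop)).const_mul _]
    exact sum_congr rfl fun k _ => integral_const_mul _ _
  have h3 : ∑ k ∈ range (n + 1), (n.choose k : ℝ) * 2 ^ (n - k) = 3 ^ n := by
    rw [show (3 : ℝ) = 1 + 2 by norm_num, add_pow]
    exact sum_congr rfl fun k _ => by rw [one_pow, one_mul, mul_comm]
  have hpp : |∫ x, p x ∂ν - ∫ x, p x ∂μ| ≤ G * 3 ^ n * D := by
    rw [hlin ν hν, hlin μ hμ, ← sum_sub_distrib]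
    calc |∑ k ∈ range (n + 1), (g ((k : ℝ) / n) * ∫ x, (n.choose k : ℝ) * x ^ k * (1 - x) ^ (n - k) ∂ν -
            g ((k : ℝ) / n) * ∫ x, (n.choose k : ℝ) * x ^ k * (1 - x) ^ (n - k) ∂μ)|
        ≤ ∑ k ∈ range (n + 1), |g ((k : ℝ) / n) * ∫ x, (n.choose k : ℝ) * x ^ k * (1 - x) ^ (n - k) ∂ν -
            g ((k : ℝ) / n) * ∫ x, (n.choose k : ℝ) * x ^ k * (1 - x) ^ (n - k) ∂μ| := abs_sum_le_sum_abs _ _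
      _ ≤ ∑ k ∈ range (n + 1), G * ((n.choose k : ℝ) * 2 ^ (n - k) * D) := by
          refine sum_le_sum fun k hk => ?_
          have hkn : k ≤ n := Nat.lt_succ_iff.mp (mem_range.mp hk)
          rw [← mul_sub, abs_mul]
          exact mul_le_mul (hG _ (hgrid k hk)) (abs_integral_bernstein_sub_le hμ hν hDj hkn) (abs_nonneg _) hG0
      _ = G * 3 ^ n * D := by rw [← mul_sum, ← sum_mul, h3]; ring
  -- assemble
  have e : ∫ x, g x ∂ν - ∫ x, g x ∂μ =
      (∫ x, g x ∂ν - ∫ x, p x ∂ν) - (∫ x, g x ∂μ - ∫ x, p x ∂μ) + (∫ x, p x ∂ν - ∫ x, p x ∂μ) := by ring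
  rw [e]
  have hsqrt : 0 < Real.sqrt n := Real.sqrt_pos.2 hnr
  calc |(∫ x, g x ∂ν - ∫ x, p x ∂ν) - (∫ x, g x ∂μ - ∫ x, p x ∂μ) + (∫ x, p x ∂ν - ∫ x, p x ∂μ)|
      ≤ |∫ x, g x ∂ν - ∫ x, p x ∂ν| + |∫ x, g x ∂μ - ∫ x, p x ∂μ| + |∫ x, p x ∂ν - ∫ x, p x ∂μ| := by
        refine (abs_add_le _ _).trans (add_le_add (abs_sub _ _) le_rfl)
    _ ≤ K / (2 * Real.sqrt n) + K / (2 * Real.sqrt n) + G * 3 ^ n * D := add_le_add (add_le_add (hgp ν hν) (hgp μ hμ)) hpp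
    _ = K / Real.sqrt n + G * (3 * A) ^ n * (n.factorial * (2 * ε * Real.exp l₀)) := by
        rw [hD, mul_pow]
        field_simp
        ring

end Price

end Summit.QuantumFields.YangMills.Theorems.BalabanUVNodesN19LawPriceUpper

end
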